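import Mathlib
import Summits.MatrixMultiplication.MatrixMultiplication.Theses.FidelityWitnesses
import Literature.Computability.AlgebraicComplexity.AlderStrassen
import Summits.MatrixMultiplication.MatrixMultiplication.Theorems.FidelityWitnessesSevenEighthsLawStubSliceElimination

/-!
# `FidelityWitnesses.SixEighthsAtFive` (stmt-MatrixMultiplication-14040) — reduction to the leave-one-out law

Support file for item `stmt-MatrixMultiplication-14040` (`SixEighthsAtFive`, `M(2,5) ≤ 6`) of route
`MatrixMultiplication/FidelityWitnesses`.  Vocabulary of the exact output elimination (tree:
`sixEighthsAtFive_of_capHardRegime`, `SevenEighthsLaw.stub_sliceElimination`): for an orthonormal frame `e`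
(coordinate inner product `⟨f,g⟩ = Σ_b Σ_c conj (f b c) · g b c` on `ℂ^{P2 × P2}`, `P2 = Fin 2 × Fin 2`),
`cap e := Σ_s Σ_a ‖Σ_μ e_s (a.1,μ) (μ,a.2)‖²` is the captured weight of `⟨2,2,2⟩` (`= 2·tr(P_E Π_W)` for the span
`E` of a basis frame), every rank-`≤ 5` tensor with products `u_l ⊗ v_l` has `|⟨S,T⟩|² ≤ ‖S‖² · cap e` for any
orthonormal frame `e` spanning the five products (slice elimination), and the item reads `cap ≤ 6` on product
`5`-planes.

THE LEAVE-ONE-OUT LAW (MIN4).  For five products `p_l = u_l ⊗ v_l` write `F_l := span{p_k : k ≠ l}` (the `l`-th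
leave-one-out `4`-plane).  (MIN4) says: SOME `F_l` captures at most the ADDITIVE value `4 = 4 · (2 · ½)` —
`cap e ≤ 4` for every orthonormal frame `e` inside `F_l`.  It implies the item in two lines
(`sixEighthsAtFive_of_leaveOneOut`): extend an orthonormal basis of `F_l` by the unit normal `r̂` of `p_l` relative
to `F_l`; the new direction adds `Σ_a ‖m(r̂) a‖² ≤ 2‖r̂‖² = 2` (`norm_sq_mul_le_two`), so the `5`-plane captures
`≤ 4 + 2 = 6`, and slice elimination finishes.  Equivalently: `f(E) ≤ 2 + max_l γ_l`, `γ_l` the `W`-weight of the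
dual direction of `p_l` — "a highly capturing configuration has a fully CRITICAL product".

STATUS OF (MIN4) (numerics of this seat, `Evidence-14040-seatc1.md` on the item): no proof; `sup min_l cap(F_l) = 4`
in 60+ local ascents of `min_l cap(F_l)` (float and 40-digit; random, structured, and adversarial starts from the
super-additive 4-configurations `cap = 4.414`, from the maximally isotropic 5-planes, from the 5-subsets of the
(MIN5)-violator below, and from the border extremisers), always ending on the flat level set
`cap(F_1) = … = cap(F_5) = 4`; at the two extremal border types of the item ALL five leave-one-out planes have
`cap(F_l) → 4` and every `γ_l → 1`.  CAVEAT: the analogous law one rung up is FALSE — there are six honest products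
with `min_l cap(5-subset) = 5.06 > 5` (total `6.65`), so (MIN4) is not an instance of a uniform principle; the rung
below (four products, some triple with `cap ≤ 3`) holds numerically.  The hypothesis is therefore recorded as a
named assumption of a kernel-checked reduction, nothing more.

Contents: `norm_sq_mul_le_two` (`Σ_a ‖m(f) a‖² ≤ 2 Σ_{b,c} ‖f b c‖²`), `sixEighthsAtFive_of_leaveOneOut`.
-/

set_option linter.dupNamespace false

namespace Summit.MatrixMultiplication.MatrixMultiplication.Theorems

open scoped BigOperators ComplexConjugate InnerProductSpace
open Literature.Computability.AlgebraicComplexity InnerProductSpace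

/-- The multiplication map is bounded by `√2` in the coordinate norms:
`Σ_a ‖Σ_μ f (a.1,μ) (μ,a.2)‖² ≤ 2 · Σ_b Σ_c ‖f b c‖²` (Cauchy–Schwarz on the two-term sums; each entry
`f b c` with `b.2 = c.1` is used exactly once). [folklore] -/
theorem norm_sq_mul_le_two (f : (Fin 2 × Fin 2) → (Fin 2 × Fin 2) → ℂ) :
    ∑ a : Fin 2 × Fin 2, ‖∑ m : Fin 2, f (a.1, m) (m, a.2)‖ ^ 2 ≤
      2 * ∑ b : Fin 2 × Fin 2, ∑ c : Fin 2 × Fin 2, ‖f b c‖ ^ 2 := by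
  have h2 : ∀ x y : ℂ, ‖x + y‖ ^ 2 ≤ 2 * (‖x‖ ^ 2 + ‖y‖ ^ 2) := by
    intro x y
    have h := norm_add_le x y
    nlinarith [h, norm_nonneg (x + y), norm_nonneg x, norm_nonneg y, sq_nonneg (‖x‖ - ‖y‖)]
  simp only [Fintype.sum_prod_type, Fin.sum_univ_two, Fin.isValue]
  have e00 := h2 (f (0, 0) (0, 0)) (f (0, 1) (1, 0))
  have e01 := h2 (f (0, 0) (0, 1)) (f (0, 1) (1, 1))
  have e10 := h2 (f (1, 0) (0, 0)) (f (1, 1) (1, 0))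
  have e11 := h2 (f (1, 0) (0, 1)) (f (1, 1) (1, 1))
  nlinarith [e00, e01, e10, e11, sq_nonneg ‖f (0, 0) (1, 0)‖, sq_nonneg ‖f (0, 0) (1, 1)‖,
    sq_nonneg ‖f (0, 1) (0, 0)‖, sq_nonneg ‖f (0, 1) (0, 1)‖, sq_nonneg ‖f (1, 0) (1, 0)‖,
    sq_nonneg ‖f (1, 0) (1, 1)‖, sq_nonneg ‖f (1, 1) (0, 0)‖, sq_nonneg ‖f (1, 1) (0, 1)‖]

/-- **`SixEighthsAtFive` from the leave-one-out law (MIN4).**  Hypothesis `hmin4`: for every five pairs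
`(u_l, v_l)` of `2 × 2` arrays there is an index `l` such that every orthonormal frame `e` (coordinate inner
product, any length `k`) lying in the span of the four products `u_j ⊗ v_j`, `j ≠ l` (enumerated by
`l.succAbove`), has `cap e ≤ 4`.  Conclusion: the route item `M(2,5) ≤ 6`.
Proof: decompose a rank-`≤ 5` tensor into five triads; take `l` from `hmin4`; in `EuclideanSpace ℂ (P2 × P2)`
take an orthonormal basis `b` of `F = span{p_j : j ≠ l}` and the residual `r = p_l − Σ_j ⟪b_j, p_l⟫ b_j ⊥ F`;
the frame `b` (if `r = 0`) or `b` followed by `r/‖r‖` (if `r ≠ 0`) is orthonormal, spans all five products, and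
has `cap ≤ 4 + 2` (`hmin4` and `norm_sq_mul_le_two`); the output slices of `S` lie in its span, and
`SevenEighthsLaw.stub_sliceElimination` gives `|⟨S,T⟩|² ≤ 6 ‖S‖²`. [folklore] -/
theorem sixEighthsAtFive_of_leaveOneOut
    (hmin4 : ∀ (u v : Fin 5 → (Fin 2 × Fin 2) → ℂ), ∃ l : Fin 5,
      ∀ (k : ℕ) (e : Fin k → (Fin 2 × Fin 2) → (Fin 2 × Fin 2) → ℂ),
        (∀ s t : Fin k, (∑ b, ∑ c, conj (e s b c) * e t b c) = if s = t then 1 else 0) →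
        (∀ s, e s ∈ Submodule.span ℂ
          (Set.range fun j : Fin 4 => fun b c => u (l.succAbove j) b * v (l.succAbove j) c)) →
        ∑ s, ∑ a : Fin 2 × Fin 2, ‖∑ m : Fin 2, e s (a.1, m) (m, a.2)‖ ^ 2 ≤ 4) :
    Summit.MatrixMultiplication.MatrixMultiplication.Theses.FidelityWitnesses.SixEighthsAtFive := by
  classical
  unfold Summit.MatrixMultiplication.MatrixMultiplication.Theses.FidelityWitnesses.SixEighthsAtFive
  intro S hS
  obtain ⟨w, u, v, hdec⟩ := exists_eq_sum_triad_of_tensorRank_le hS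
  obtain ⟨l, hl⟩ := hmin4 u v
  -- ambient Euclidean space and the back-conversion to curried arrays
  let V := EuclideanSpace ℂ ((Fin 2 × Fin 2) × (Fin 2 × Fin 2))
  let ψ : V →ₗ[ℂ] (Fin 2 × Fin 2) → (Fin 2 × Fin 2) → ℂ :=
    { toFun := fun x b c => x (b, c)
      map_add' := fun _ _ => rfl
      map_smul' := fun _ _ => rfl }
  have key : ∀ x y : EuclideanSpace ℂ ((Fin 2 × Fin 2) × (Fin 2 × Fin 2)),
      (∑ b, ∑ c, conj (x (b, c)) * y (b, c)) = ⟪x, y⟫_ℂ := by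
    intro x y
    simp only [PiLp.inner_apply, RCLike.inner_apply]
    rw [Fintype.sum_prod_type (f := fun bc => y bc * conj (x bc))]
    exact Finset.sum_congr rfl fun b _ => Finset.sum_congr rfl fun c _ => mul_comm _ _
  -- the five products as vectors
  let P : Fin 5 → V := fun i => WithLp.toLp 2 fun bc => u i bc.1 * v i bc.2
  have hψP : ∀ i, ψ (P i) = fun b c => u i b * v i c := fun i => rfl
  -- the leave-one-out plane and an orthonormal basis of it
  let F : Submodule ℂ V := Submodule.span ℂ (Set.range fun j : Fin 4 => P (l.succAbove j))
  let b := stdOrthonormalBasis ℂ F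
  set k := Module.finrank ℂ F with hk
  let bv : Fin k → V := fun j => (b j : V)
  have hbv_on : Orthonormal ℂ bv := by
    rw [orthonormal_iff_ite]
    intro i j
    have := orthonormal_iff_ite.mp b.orthonormal i j
    simpa [bv, Submodule.coe_inner] using this
  have hbv_mem : ∀ j, bv j ∈ F := fun j => (b j).2
  -- residual of `P l` relative to `F`
  let c : Fin k → ℂ := fun j => ⟪bv j, P l⟫_ℂ
  let xF : V := ∑ j, c j • bv j
  have hxF_mem : xF ∈ F := Submodule.sum_mem _ fun j _ => Submodule.smul_mem _ _ (hbv_mem j)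
  let r : V := P l - xF
  have hr_orth : ∀ i, ⟪bv i, r⟫_ℂ = 0 := by
    intro i
    have hon := orthonormal_iff_ite.mp hbv_on
    show ⟪bv i, P l - ∑ j, c j • bv j⟫_ℂ = 0
    rw [inner_sub_right, inner_sum]
    simp_rw [inner_smul_right]
    have hx : ∀ x, c x * ⟪bv i, bv x⟫_ℂ = if i = x then ⟪bv i, P l⟫_ℂ else 0 := by
      intro x
      rw [hon i x]
      split_ifs with h
      · subst h; simp [c]
      · simp
    simp_rw [hx, Finset.sum_ite_eq, Finset.mem_univ, if_true, sub_self]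
  have hPl : P l = xF + r := by simp [r]
  -- products other than `l` lie in `F`
  have hPF : ∀ i, i ≠ l → P i ∈ F := by
    intro i hi
    obtain ⟨j, hj⟩ := Fin.exists_succAbove_eq hi
    exact Submodule.subset_span ⟨j, by simp [hj]⟩
  -- `F` is spanned by the basis vectors `bv`
  have hF_le : F ≤ Submodule.span ℂ (Set.range bv) := by
    intro x hx
    have hx' : (⟨x, hx⟩ : F) = ∑ j, b.repr ⟨x, hx⟩ j • b j := (b.sum_repr ⟨x, hx⟩).symm
    have : x = ∑ j, b.repr ⟨x, hx⟩ j • bv j := by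
      have := congrArg (fun y : F => (y : V)) hx'
      simpa [bv] using this
    rw [this]
    exact Submodule.sum_mem _ fun j _ => Submodule.smul_mem _ _ (Submodule.subset_span ⟨j, rfl⟩)
  -- the frame inside `F`, in curried form, satisfies the hypotheses of `hl`
  let e' : Fin k → (Fin 2 × Fin 2) → (Fin 2 × Fin 2) → ℂ := fun s b c => bv s (b, c)
  have he' : ∀ s t : Fin k, (∑ b, ∑ c, conj (e' s b c) * e' t b c) = if s = t then 1 else 0 := by
    intro s t
    rw [← orthonormal_iff_ite.mp hbv_on s t]
    exact key _ _
  have he'_span : ∀ s, e' s ∈ Submodule.span ℂ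
      (Set.range fun j : Fin 4 => fun b c => u (l.succAbove j) b * v (l.succAbove j) c) := by
    intro s
    have hs : bv s ∈ F := hbv_mem s
    have := Submodule.apply_mem_span_image_of_mem_span ψ hs
    rw [← Set.range_comp] at this
    exact this
  have hcap' : (∑ s, ∑ a : Fin 2 × Fin 2, ‖∑ m : Fin 2, e' s (a.1, m) (m, a.2)‖ ^ 2) ≤ 4 :=
    hl k e' he' he'_span
  have hnn : (0 : ℝ) ≤ ∑ a, ∑ b, ∑ c, ‖S a b c‖ ^ 2 := by positivity
  -- slices of `S` are combinations of the five products
  have hslice : ∀ a : Fin 2 × Fin 2, S a = ∑ i, w i a • ψ (P i) := by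
    intro a
    rw [hdec]
    funext b' c'
    simp [Finset.sum_apply, triad_apply, ψ, P, mul_assoc]
  by_cases hr0 : r = 0
  · -- all five products lie in `F`: the frame `e'` already spans the slices
    have hPall : ∀ i, P i ∈ Submodule.span ℂ (Set.range bv) := by
      intro i
      by_cases hi : i = l
      · subst hi
        have : P i = xF := by rw [hPl, hr0, add_zero]
        rw [this]; exact hF_le hxF_mem
      · exact hF_le (hPF i hi)
    have hSspan : ∀ a : Fin 2 × Fin 2, S a ∈ Submodule.span ℂ (Set.range e') := by
      intro a
      rw [hslice a]
      refine Submodule.sum_mem _ fun i _ => Submodule.smul_mem _ _ ?_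
      have := Submodule.apply_mem_span_image_of_mem_span ψ (hPall i)
      rw [← Set.range_comp] at this
      exact this
    have h1 := SevenEighthsLaw.stub_sliceElimination e' he' S hSspan
    calc ‖∑ a, ∑ b, ∑ c, S a b c * matMulTensor ℂ 2 2 2 a b c‖ ^ 2
        ≤ (∑ a, ∑ b, ∑ c, ‖S a b c‖ ^ 2) *
            ∑ s, ∑ a : Fin 2 × Fin 2, ‖∑ m : Fin 2, e' s (a.1, m) (m, a.2)‖ ^ 2 := h1
      _ ≤ (∑ a, ∑ b, ∑ c, ‖S a b c‖ ^ 2) * 6 :=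
          mul_le_mul_of_nonneg_left (hcap'.trans (by norm_num)) hnn
      _ = 6 * ∑ a, ∑ b, ∑ c, ‖S a b c‖ ^ 2 := by ring
  · -- extend the frame by the unit residual `r / ‖r‖`
    have hrn : ‖r‖ ≠ 0 := norm_ne_zero_iff.mpr hr0
    have hrpos : 0 < ‖r‖ := norm_pos_iff.mpr hr0
    let rh : V := (‖r‖⁻¹ : ℂ) • r
    have hrC : ((‖r‖ : ℝ) : ℂ) ≠ 0 := by exact_mod_cast hrn
    have hrh_norm : ⟪rh, rh⟫_ℂ = 1 := by
      simp only [rh, inner_smul_left, inner_smul_right, inner_self_eq_norm_sq_to_K, map_inv₀,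
        Complex.conj_ofReal]
      field_simp
      norm_cast
    have hrh_orth : ∀ i, ⟪bv i, rh⟫_ℂ = 0 := by
      intro i; simp [rh, hr_orth i]
    -- the extended frame on `Fin (k + 1)`
    let E2 : Fin (k + 1) → V := Fin.snoc bv rh
    have hE2_cast : ∀ j : Fin k, E2 (Fin.castSucc j) = bv j := fun j => by simp [E2]
    have hE2_last : E2 (Fin.last k) = rh := by simp [E2]
    have hE2_on : Orthonormal ℂ E2 := by
      rw [orthonormal_iff_ite]
      intro s t
      refine Fin.lastCases ?_ (fun s' => ?_) s <;> refine Fin.lastCases ?_ (fun t' => ?_) t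
      · rw [hE2_last, hrh_norm, if_pos rfl]
      · rw [hE2_last, hE2_cast, ← inner_conj_symm, hrh_orth t']
        simp [(Fin.castSucc_lt_last t').ne']
      · rw [hE2_last, hE2_cast, hrh_orth s']
        simp [(Fin.castSucc_lt_last s').ne]
      · rw [hE2_cast, hE2_cast, orthonormal_iff_ite.mp hbv_on s' t']
        simp [Fin.castSucc_inj]
    let e2 : Fin (k + 1) → (Fin 2 × Fin 2) → (Fin 2 × Fin 2) → ℂ := fun s b c => E2 s (b, c)
    have he2 : ∀ s t : Fin (k + 1), (∑ b, ∑ c, conj (e2 s b c) * e2 t b c) = if s = t then 1 else 0 := by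
      intro s t
      rw [← orthonormal_iff_ite.mp hE2_on s t]
      exact key _ _
    -- all five products lie in the span of `E2`
    have hbvE2 : ∀ j, bv j ∈ Submodule.span ℂ (Set.range E2) := fun j =>
      Submodule.subset_span ⟨Fin.castSucc j, hE2_cast j⟩
    have hF_E2 : F ≤ Submodule.span ℂ (Set.range E2) :=
      hF_le.trans (Submodule.span_le.mpr (by rintro _ ⟨j, rfl⟩; exact hbvE2 j))
    have hPall : ∀ i, P i ∈ Submodule.span ℂ (Set.range E2) := by
      intro i
      by_cases hi : i = l
      · subst hi
        rw [hPl]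
        refine Submodule.add_mem _ (hF_E2 hxF_mem) ?_
        have hr_eq : r = (‖r‖ : ℂ) • rh := by
          simp only [rh, smul_smul]
          rw [mul_inv_cancel₀ (by exact_mod_cast hrn), one_smul]
        rw [hr_eq]
        exact Submodule.smul_mem _ _ (Submodule.subset_span ⟨Fin.last k, hE2_last⟩)
      · exact hF_E2 (hPF i hi)
    have hSspan : ∀ a : Fin 2 × Fin 2, S a ∈ Submodule.span ℂ (Set.range e2) := by
      intro a
      rw [hslice a]
      refine Submodule.sum_mem _ fun i _ => Submodule.smul_mem _ _ ?_
      have := Submodule.apply_mem_span_image_of_mem_span ψ (hPall i)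
      rw [← Set.range_comp] at this
      exact this
    -- capture of the extended frame: `≤ 4 + 2`
    have hcap2 : (∑ s, ∑ a : Fin 2 × Fin 2, ‖∑ m : Fin 2, e2 s (a.1, m) (m, a.2)‖ ^ 2) ≤ 6 := by
      rw [Fin.sum_univ_castSucc]
      have hA : (∑ s : Fin k, ∑ a : Fin 2 × Fin 2,
          ‖∑ m : Fin 2, e2 (Fin.castSucc s) (a.1, m) (m, a.2)‖ ^ 2) ≤ 4 := by
        have : ∀ s : Fin k, e2 (Fin.castSucc s) = e' s := by
          intro s; funext b' c'; simp [e2, e', hE2_cast]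
        simp only [this]
        exact hcap'
      have hB : (∑ a : Fin 2 × Fin 2, ‖∑ m : Fin 2, e2 (Fin.last k) (a.1, m) (m, a.2)‖ ^ 2) ≤ 2 := by
        have h1 := norm_sq_mul_le_two (e2 (Fin.last k))
        have h2 : (∑ b' : Fin 2 × Fin 2, ∑ c' : Fin 2 × Fin 2, ‖e2 (Fin.last k) b' c'‖ ^ 2) = 1 := by
          have h3 := he2 (Fin.last k) (Fin.last k)
          simp only [if_true] at h3
          have h4 : ∀ b' c', conj (e2 (Fin.last k) b' c') * e2 (Fin.last k) b' c' =
              ((‖e2 (Fin.last k) b' c'‖ ^ 2 : ℝ) : ℂ) := by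
            intro b' c'; rw [RCLike.conj_mul]; norm_cast
          simp only [h4] at h3
          exact_mod_cast h3
        rw [h2] at h1
        linarith
      linarith
    have h1 := SevenEighthsLaw.stub_sliceElimination e2 he2 S hSspan
    calc ‖∑ a, ∑ b, ∑ c, S a b c * matMulTensor ℂ 2 2 2 a b c‖ ^ 2
        ≤ (∑ a, ∑ b, ∑ c, ‖S a b c‖ ^ 2) *
            ∑ s, ∑ a : Fin 2 × Fin 2, ‖∑ m : Fin 2, e2 s (a.1, m) (m, a.2)‖ ^ 2 := h1
      _ ≤ (∑ a, ∑ b, ∑ c, ‖S a b c‖ ^ 2) * 6 := mul_le_mul_of_nonneg_left hcap2 hnn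
      _ = 6 * ∑ a, ∑ b, ∑ c, ‖S a b c‖ ^ 2 := by ring

end Summit.MatrixMultiplication.MatrixMultiplication.Theorems
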